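import Summits.BirchSwinnertonDyer.BirchSwinnertonDyer.Theses.BiquadraticEisensteinDescent
import Summits.BirchSwinnertonDyer.BirchSwinnertonDyer.Theorems.BiquadraticEisensteinDescentHeegnerTwistCouplingInSupplyNonNullFailsAtTwo
import HarnessLib

set_option linter.dupNamespace false
set_option autoImplicit false

/-!
# Sketch (crux-ideate seat 1, g37, round 1) — first lemmas for the crux idea
# `heavy-discriminant-sparsity` on `HeegnerTwistCouplingInSupply` (stmt-BirchSwinnertonDyer-21381)

Lever.  `p ∣ h(d)` forces `d` to be HEAVY: `h(d) ≥ 2^{ω(|d|)−1}·p` (genus theory, tree lemma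
`two_pow_card_primeFactors_sub_one_dvd_classNumber`).  Heavy Heegner discriminants are SPARSE in every
window `|d| ≤ A·p²` (`HeavySparse`, the W-free / L-free research lemma of the line: a heavy `d` has either
`ω(|d|) < m` — Hardy–Ramanujan few-prime-factor count, density `→ 0` — or `L(1,χ_d) ≥ π·2^{m−1}/√A` —
Granville–Soundararajan / Barban–Jutila moment tails), so the bulk of the crux reduces by PIGEONHOLE
(`door_shape`, proved below for one corner pair) to POSITIVE-PROPORTION non-vanishing of the Heegner twists
at the completion scale `|d| ≤ A·p²` (`PropNVAtScale`), where the `p`-selector sums of the descent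
certificates complete (Taniguchi–Thorne orbital exponential sums).  Nothing below is asserted as true
except the proved pointwise lemmas; `HeavySparse` and `PropNVAtScale` are OPEN statements (Props);
BSD is not proved by any of this and stmt-21381 is NOT closed.
-/

noncomputable section

open scoped NumberField Classical
open WeierstrassCurve NumberField
open Literature.NumberTheory.EllipticCurves

namespace Summit.BirchSwinnertonDyer.BirchSwinnertonDyer.Cruxes.HeegnerTwistCouplingInSupply.SeatOneG37

/-! ## The two families -/

/-- `d` is a Heegner discriminant of level `N`: the discriminant of an imaginary quadratic field `K` with
`|d| > 4` in which every prime dividing `N` splits (the crux's own currency). -/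
def IsHeegnerDisc (N : ℕ) (d : ℤ) : Prop :=
  ∃ (K : Type) (_ : Field K) (_ : NumberField K),
    IsImaginaryQuadratic K ∧ NumberField.discr K = d ∧ 4 < d.natAbs ∧ SatisfiesHeegnerHypothesis N K

/-- `d` is a HEAVY Heegner discriminant of level `N` for the prime `p`: additionally
`2^{ω(|d|)−1}·p ≤ h(K)`.  By genus theory `p ∣ h(K)` implies heaviness (`heavy_of_dvd_classNumber`). -/
def IsHeavyDisc (N p : ℕ) (d : ℤ) : Prop :=
  ∃ (K : Type) (_ : Field K) (_ : NumberField K),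
    IsImaginaryQuadratic K ∧ NumberField.discr K = d ∧ 4 < d.natAbs ∧ SatisfiesHeegnerHypothesis N K ∧
      2 ^ (d.natAbs.primeFactors.card - 1) * p ≤ NumberField.classNumber K

/-! ## Pointwise genus step (proved): `p ∣ h ⟹ heavy`, contrapositive `light ⟹ p ∤ h` -/

/-- Genus theory + coprimality: for `K` imaginary quadratic and `p` an odd prime, `p ∣ h_K` forces
`2^{ω(|d_K|)−1}·p ≤ h_K`. [cite: Cox2013, §3.B Thm. 3.15] -/
theorem heavy_of_dvd_classNumber {K : Type*} [Field K] [NumberField K] (hK : IsImaginaryQuadratic K)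
    {p : ℕ} (hp : p.Prime) (hp2 : p ≠ 2) (hdvd : p ∣ NumberField.classNumber K) :
    2 ^ ((NumberField.discr K).natAbs.primeFactors.card - 1) * p ≤ NumberField.classNumber K := by
  set g := 2 ^ ((NumberField.discr K).natAbs.primeFactors.card - 1) with hg
  have hgen : g ∣ NumberField.classNumber K :=
    Summit.BirchSwinnertonDyer.BirchSwinnertonDyer.Theorems.BiquadraticEisensteinDescentHeegnerTwistCouplingInSupplyNonNullFailsAtTwo.two_pow_card_primeFactors_sub_one_dvd_classNumber
      hK
  have hcop : Nat.Coprime g p :=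
    (Nat.Coprime.pow_left _ ((Nat.coprime_primes Nat.prime_two hp).2 (Ne.symm hp2)))
  have hmul : g * p ∣ NumberField.classNumber K := Nat.Coprime.mul_dvd_of_dvd_of_dvd hcop hgen hdvd
  exact Nat.le_of_dvd Fintype.card_pos hmul

/-- The certificate used by the pigeonhole: a LIGHT field (`h_K < 2^{ω−1}·p`) has `p ∤ h_K`. -/
theorem not_dvd_classNumber_of_light {K : Type*} [Field K] [NumberField K] (hK : IsImaginaryQuadratic K)
    {p : ℕ} (hp : p.Prime) (hp2 : p ≠ 2)
    (hlt : NumberField.classNumber K < 2 ^ ((NumberField.discr K).natAbs.primeFactors.card - 1) * p) :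
    ¬ p ∣ NumberField.classNumber K :=
  fun h ↦ absurd (heavy_of_dvd_classNumber hK hp hp2 h) (not_le.mpr hlt)

/-! ## The two research statements of the line (Props, not asserted) -/

/-- **HEAVY SPARSITY** (W-free, `L`-free; the new lever).  For every prime-to-`p` level part `N₀`, window
constant `A` and `η > 0`, for all sufficiently large primes `p`, the heavy Heegner discriminants of level
`N₀·p²` with `|d| ≤ A·p²` are at most an `η`-fraction of all Heegner discriminants of that level in that
window.  Expected proof: heavy ⟹ `ω(|d|) < m` or `L(1,χ_d) = π h/√|d| ≥ π 2^{m−1}/√A`; Hardy–Ramanujan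
bounds the first set by `≪ A p² (log log p)^{m−2}/log p`, a `2k`-th moment of `L(1,χ_d)` (Barban, Jutila;
Granville–Soundararajan 2003 Thm 2) bounds the second by `≪_k A p² (√A/2^{m})^{2k}`. -/
def HeavySparse : Prop :=
  ∀ (N₀ A : ℕ) (η : ℝ), 0 < N₀ → 0 < A → 0 < η → ∃ p₀ : ℕ, ∀ p : ℕ, p.Prime → p₀ ≤ p →
    (Nat.card {d : ℤ | d.natAbs ≤ A * p ^ 2 ∧ IsHeavyDisc (N₀ * p ^ 2) p d} : ℝ) ≤
      η * Nat.card {d : ℤ | d.natAbs ≤ A * p ^ 2 ∧ IsHeegnerDisc (N₀ * p ^ 2) d}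

/-- **POSITIVE-PROPORTION NON-VANISHING AT THE COMPLETION SCALE** for a set `𝒞` of corner pairs `(W, p)`
(the `L`-side target the lever transfers the bulk of the crux to): one window `A`, one proportion `δ > 0`
and one threshold `p₁` such that for every `(W, p) ∈ 𝒞` with `p ≥ p₁`, at least `δ·#{Heegner d of level
N_W, |d| ≤ A p²}` of those `d` have `L(W^{(d)}, 1) ≠ 0`.  OPEN in this uniformity; in the `j = 0` /
Kriz–Li corners it is a Davenport–Heilbronn count with local conditions at `p ≍ √X` (completion range). -/
def PropNVAtScale (𝒞 : WeierstrassCurve ℚ → ℕ → Prop) : Prop :=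
  ∃ (A : ℕ) (δ : ℝ) (p₁ : ℕ), 0 < A ∧ 0 < δ ∧
    ∀ (W : WeierstrassCurve ℚ) [W.IsElliptic] (p : ℕ), 𝒞 W p → p₁ ≤ p →
      δ * (Nat.card {d : ℤ | d.natAbs ≤ A * p ^ 2 ∧ IsHeegnerDisc (W.conductorNorm ℤ) d} : ℝ) <
        Nat.card {d : ℤ | d.natAbs ≤ A * p ^ 2 ∧ IsHeegnerDisc (W.conductorNorm ℤ) d ∧
          (W.quadraticTwist (d : ℚ)).entireLFunction 1 ≠ 0}

/-! ## The door (pigeonhole), at one corner pair -/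

/-- **DOOR SHAPE (proved): strictly more non-vanishing than heavy ⟹ the crux's conclusion at `(W, p)`.**
If, in some finite window, the Heegner `d` of level `N_W` with `L(W^{(d)},1) ≠ 0` are NOT all heavy (here:
one explicit light non-vanishing `d` is handed over, which is what a strict count inequality between the two
finite sets produces), then there is a Heegner field `K′` with `L(W^{(d_{K′})}, 1) ≠ 0` and `p ∤ h(K′)` —
the conclusion of `HeegnerTwistCouplingInSupply` at `(W, p)` (its hypotheses are not even needed). -/
theorem door_shape (W : WeierstrassCurve ℚ) [W.IsElliptic] {p : ℕ} (hp : p.Prime) (hp2 : p ≠ 2)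
    (K : Type) [Field K] [NumberField K] (hK : IsImaginaryQuadratic K)
    (h4 : 4 < (NumberField.discr K).natAbs) (hH : SatisfiesHeegnerHypothesis (W.conductorNorm ℤ) K)
    (hL : (W.quadraticTwist (NumberField.discr K : ℚ)).entireLFunction 1 ≠ 0)
    (hlight : NumberField.classNumber K < 2 ^ ((NumberField.discr K).natAbs.primeFactors.card - 1) * p) :
    ∃ (K : Type) (_ : Field K) (_ : NumberField K),
      IsImaginaryQuadratic K ∧ 4 < (NumberField.discr K).natAbs ∧
        SatisfiesHeegnerHypothesis (W.conductorNorm ℤ) K ∧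
        (W.quadraticTwist (NumberField.discr K : ℚ)).entireLFunction 1 ≠ 0 ∧ ¬ p ∣ NumberField.classNumber K :=
  ⟨K, inferInstance, inferInstance, hK, h4, hH, hL, not_dvd_classNumber_of_light hK hp hp2 hlight⟩

/-- **TRANSFER SHAPE** (statement only): heavy sparsity and positive-proportion non-vanishing at scale on a
corner set `𝒞` give the crux's conclusion for every `(W, p) ∈ 𝒞` with `p` large — the bulk.  (The finite
set bookkeeping `#NV > #Heavy ⟹ ∃ d ∈ NV ∖ Heavy` and the identification of the two fields with
discriminant `d` are routine and left to the crux-plan seat; recorded here as the target signature.) -/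
def BulkTransfer (𝒞 : WeierstrassCurve ℚ → ℕ → Prop) : Prop :=
  HeavySparse → PropNVAtScale 𝒞 → ∃ p₂ : ℕ, ∀ (W : WeierstrassCurve ℚ) [W.IsElliptic] (p : ℕ), 𝒞 W p → p₂ ≤ p → p.Prime →
    ∃ (K : Type) (_ : Field K) (_ : NumberField K),
      IsImaginaryQuadratic K ∧ 4 < (NumberField.discr K).natAbs ∧
        SatisfiesHeegnerHypothesis (W.conductorNorm ℤ) K ∧
        (W.quadraticTwist (NumberField.discr K : ℚ)).entireLFunction 1 ≠ 0 ∧ ¬ p ∣ NumberField.classNumber K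

end Summit.BirchSwinnertonDyer.BirchSwinnertonDyer.Cruxes.HeegnerTwistCouplingInSupply.SeatOneG37

end
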